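import Summits.Ventures.YMGap.RobustBall.BoundaryDecayMixedAction
import Summits.Ventures.YMGap.RobustBall.BoundaryDecayDim
import Summits.Ventures.YMGap.RobustBall.WilsonLoopBoundaryDecay
import Summits.Ventures.YMGap.RobustBall.FreeBoundaryDecay
import Summits.Ventures.YMGap.Thresholds.OneLinkLevelTwoBootTildeRows
import Summits.Ventures.YMGap.Thresholds.OneLinkLevelTwoBootTildeAreaLaw
import Summits.Ventures.YMGap.Thresholds.OneLinkLevelTwoBootTildeDimRows
import Summits.Ventures.YMGap.Thresholds.OneLinkLevelTwoBootRowsMore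
import Summits.Ventures.YMGap.Thresholds.StarSU3PV2DimRows
import Summits.Ventures.YMGap.RobustBall.MassGapOnBallZdGRowsSU3PV2
import Summits.Ventures.YMGap.RobustBall.StarRowsSU3PV2Dim3
import HarnessLib

/-!
# Venture statement — YMGap (cell `pub-ymgap`) — CONJUNCT BODIES T58, T59 (boundary-rate variants: mixed action, d = 3, Wilson loops, free b.c.), T46 (track (a): the every-N level-two ladder), T60 (SU(3) PV2 column, every dimension) (V22, block 2 of 4)

STATUS: FILED by p2 g12 as contingent filer under lead R299 (bus 2026-08-23T22:22:12Z) on the lead's V22 BOOKING line, quoted verbatim: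
«2026-08-23T23:50:48Z lead (g8) → ★ V22 BOOKING (R294/R299/R301; lead g8) → p2 (g12) [inject verbatim via mkcandidates.sh], referee (g30), p3 (g7),
writer (g12), rb-theory (g16) cc owners: `StatementConjunctsV22.lean` = block A dff4d65aabaff373 (372 l) (T55a–d·T55 rb-p2 FreeEnergyLaw; T56a–e·T56
ds-1 Pressure-A; T57a,b·T57 ds-3 part D) · `…V22B.lean` = block B 609b24d462b1cfbc (382 l) (T58a,b·T58; T59a,b·T59; T46a–c·T46; T60a,b·T60) ·
`…V22C.lean` = block C e081844ac208ac1b (342 l) (T62a–e·T62 ds-3 part B; T63 ds-3 part H; T65a,b·T65 ds-4 CentreTube) · `…V22D.lean` = block D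
a5d811943bcc1fdb (155 l; T61a–d·T61 ds-1 Pressure-B) «4 of 4»; numbered base A 6af97ec141cbb745 / B e6e71cdd58a392a0 / C bdd095e9b6ac86ce / D
701ed23113043693 (numbered monolith 61108ff1cf2b97b8; byte-compare 35/35); map v1 127e243484fe3a02 + addenda 2254c71f1c2725b3; FINAL SET = p2 l.4946
(re-probe 23:44–23:47Z: T65/T61 GREEN, T64 rc 75). Every conjunct restates BY NAME a theorem already ACCEPTED in the tree (statement-index
bookkeeping; finite lattice, strong/intermediate coupling; nothing continuum / OS / infinite-volume-limit-as-physics / mass gap / Clay). Filer p2 g12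
per R299 (p3 g7 does NOT claim; fallback only if no p2 INTENT/SUBMITTED by 00:30Z): `--kind definition`, ≤ 400 l/block, dry-runs, 00:10Z INTENT check,
file A → B → C → D, ONE «SUBMITTED» line with pids + filed sha16s + consolidating decl names per block; referee g30 legs on FILED bytes; lead books on
ACCEPT + commit. V23 = T64a–e·T64 (rb-p1, unbuilt parent at the re-probe; numbered-PENDING 9e47a244954cc2f4), T65c (ds-4), T66a–e (ds-3), T67a–d +
T68a (rb-p2 098236ae25992b7a); no T68b. RECORD: v1.11 `YMGapStatementV1_11` p368908 7bed0099cf4c OF RECORD (l.4883); v1.12 := v1.11 ∧ V22 ∧ V22B ∧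
V22C ∧ V22D by a later seat after V22* are built (p3 l.4789 (3), tools-p3/mkindex_next.py).».
Second of four V22 block files (the first,
`StatementConjunctsV22.lean`, carries T55, T56, T57; the third, `StatementConjunctsV22C.lean`, T62, T63, T65; the fourth, `StatementConjunctsV22D.lean`, T61).  Texts: T58 = seat ds-3 g12's part F (`HOME/ds/ds3/lean/g12/texts/V1XConjunctsDS3g12F.lean` 3a2476c625eadf90)
VERBATIM; T59 = ds-3 g12's part G (`…/V1XConjunctsDS3g12G.lean` 63aad1deced79fea) VERBATIM; T46 = seat p2 g11's text for the reserved number T46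
(`HOME/p2/v22-prestage/T-texts-p2g11.lean` 38831d14bcc5cda6) VERBATIM, its own conjunction `T46_SUNLevelTwoLadder` included; T60 = the engine-2 PV2 text drafted by p2 g11
from the tree declarations and COUNTERSIGNED AS TYPED by engine-2 g11 (bus 2026-08-23T19:33:37Z; `HOME/p2/v22-prestage/T-texts-engine2-PV2-countersigned.lean` 1c4332b7d1ec2429)
VERBATIM.  Only decl names change (map of record `RENAMES-PROPOSAL.txt` 127e243484fe3a02, lead R294); `T58_…`, `T59_…`, `T60_…` are the pre-stage default conjunctions.

HONEST FRAMING. WHAT THIS IS: bodies `Tk_… : Prop` + witnesses `Tk_…_holds`, kernel-checked with NO hypothesis, closing by TREE constants only. STRONG-COUPLING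
LATTICE statements about `SU(N)` lattice Yang–Mills with the Wilson action / mixed fundamental–adjoint members / the typed balls (T58, T59: explicit rates at which
box, loop and free-boundary expectations reach the one DLR state), the track-(a) every-`N` level-two threshold / area-law / dimension ladders (T46: door artefacts of the
one-link level-two modulus, FINAL at that level per lead R288, sentence-grade, additional to T11/T16), and the hypothesis-free `SU(3)` PV2 column in every dimension with
its ball segments (T60).  Every window, radius or threshold is where a BOUND closes, not a transition.  WHAT THIS IS NOT: nothing for `SU(2)` in T60, no uniformity in
`N` beyond what each conjunct states, no sharpness of thresholds, nothing about the crossover, scaling, a continuum limit, confinement in the continuum, or the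
Yang–Mills Millennium problem.
-/

noncomputable section

namespace Summit.Ventures.YMGap

/-! ### OWNER FILE `ds/ds3/lean/g12/texts/V1XConjunctsDS3g12F.lean` (sha16 3a2476c625eadf90) — section `V22_ds3_PartF` -/
section V22_ds3_PartF

/-!
Statement v1.x candidate conjuncts from ds-3's gen-12 files, PART F (TEXT for the p3 seat; checkable once `BoundaryDecayMixedAction.lean`
(p368163) and `BoundaryDecayDim.lean` (p368214) are IN THE TREE; NOT proposed by ds-3). Y2 ROBUST-BALL: ONE STATE AT A RATE for the named
mixed fundamental–adjoint `SU(2)` member, and for the `SU(2)` Wilson action on `ℤ³`. HONEST LABEL: Dobrushin-comparison lower bounds on the rate;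
lattice strong coupling; nothing continuum.
-/

open MeasureTheory Filter Topology
open scoped NNReal
open Literature.Probability.LatticeModels hiding configShift configShift_apply
open Literature.MathematicalPhysics.QuantumLattice (fundamentalRep ZdEdge LGConfig ymSpecification ymGibbsMeasures)
open Literature.MathematicalPhysics.QuantumFieldTheory (IsLipschitzCylinder)
open Summit.Ventures.YMGap
open Summit.Ventures.YMGap.RobustBall

/-- **T58a_SU2MixedActionBoundaryRate — the MIXED FUNDAMENTAL–ADJOINT `SU(2)` ACTION on `ℤ⁴` at `β_W = 1/8`, `|t| ≤ 1/100`** (rb-p1's member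
`adjointWitness t`, support family `plaquetteSupp`; the cell of `su2_mixedAction_massGap_1_8`): for every DLR state `μ` of the member, every finite
volume `Λ`, EVERY boundary field `η` and every Lipschitz cylinder `F` (constant `K`, links `Δ` at depth `≥ D` in `Λ`):
`|∫ F dγ_Λ(· | η) − ∫ F dμ| ≤ 2√2 · K · #Δ · (49/50)^{⌊D⌋}` (`RobustBall.su2_mixedAction_boundary_1_8`). -/
def T58a_SU2MixedActionBoundaryRate : Prop :=
  ∀ (t : ℝ), |t| ≤ 1 / 100 →
    ∀ μ ∈ perturbedGibbsMeasures (d := 4) (fundamentalRep (Fin 2)) ((2 : ℕ) * ((1 / 8 : ℝ) / 4)) (adjointWitness t) plaquetteSupp,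
    ∀ (Λ : Finset (ZdEdge 4)) (η : LGConfig 4 (Matrix.specialUnitaryGroup (Fin 2) ℂ))
      (F : LGConfig 4 (Matrix.specialUnitaryGroup (Fin 2) ℂ) → ℝ) (Δ : Finset (ZdEdge 4)) (K : ℝ≥0),
      IsLipschitzCylinder (fundamentalRep (Fin 2)) F Δ K → ∀ D : ℝ, (∀ y ∈ Δ, ∀ z, z ∉ Λ → D ≤ ‖y.1 - z.1‖) →
        |(∫ U, F U ∂(perturbedYM (d := 4) (fundamentalRep (Fin 2)) ((2 : ℕ) * ((1 / 8 : ℝ) / 4)) (adjointWitness t) plaquetteSupp Λ η)) -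
            ∫ U, F U ∂μ| ≤ 2 * Real.sqrt 2 * K * Δ.card * (49 / 50 : ℝ) ^ ⌊D⌋₊

/-- T58a_SU2MixedActionBoundaryRate holds. -/
theorem T58a_SU2MixedActionBoundaryRate_holds : T58a_SU2MixedActionBoundaryRate :=
  fun _ ht _ hμ Λ η _ _ _ hF _ hD => su2_mixedAction_boundary_1_8 ht hμ Λ η hF hD

/-- **T58b_SU2Dim3BoundaryRate — THREE-DIMENSIONAL `SU(2)` LATTICE YANG–MILLS, `0 ≤ β_W ≤ 1/8`** (tree coupling `β_W/2`): for every DLR state `μ`,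
every finite volume `Λ`, EVERY boundary field `η` and every Lipschitz cylinder at depth `≥ D` in `Λ`:
`|∫ F dγ_Λ(· | η) − ∫ F dμ| ≤ 2√2 · K · #Δ · (1/2)^{⌊D⌋}`; for `1/8 ≤ β_W < 1/4` the same with `(4β_W)^{⌊D⌋}`
(`RobustBall.su2_wilson_boundary_dim3_upTo_oneEighth`, `…_lt_oneQuarter`). -/
def T58b_SU2Dim3BoundaryRate : Prop :=
  (∀ (βW : ℝ), 0 ≤ βW → βW ≤ 1 / 8 →
    ∀ μ ∈ ymGibbsMeasures (d := 3) (fundamentalRep (Fin 2)) (βW / 2),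
    ∀ (Λ : Finset (ZdEdge 3)) (η : LGConfig 3 (Matrix.specialUnitaryGroup (Fin 2) ℂ))
      (F : LGConfig 3 (Matrix.specialUnitaryGroup (Fin 2) ℂ) → ℝ) (Δ : Finset (ZdEdge 3)) (K : ℝ≥0),
      IsLipschitzCylinder (fundamentalRep (Fin 2)) F Δ K → ∀ D : ℝ, (∀ y ∈ Δ, ∀ z, z ∉ Λ → D ≤ ‖y.1 - z.1‖) →
        |(∫ U, F U ∂(ymSpecification (d := 3) (fundamentalRep (Fin 2)) (βW / 2) Λ η)) - ∫ U, F U ∂μ| ≤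
          2 * Real.sqrt 2 * K * Δ.card * (1 / 2 : ℝ) ^ ⌊D⌋₊) ∧
  (∀ (βW : ℝ), 1 / 8 ≤ βW → βW < 1 / 4 →
    ∀ μ ∈ ymGibbsMeasures (d := 3) (fundamentalRep (Fin 2)) (βW / 2),
    ∀ (Λ : Finset (ZdEdge 3)) (η : LGConfig 3 (Matrix.specialUnitaryGroup (Fin 2) ℂ))
      (F : LGConfig 3 (Matrix.specialUnitaryGroup (Fin 2) ℂ) → ℝ) (Δ : Finset (ZdEdge 3)) (K : ℝ≥0),
      IsLipschitzCylinder (fundamentalRep (Fin 2)) F Δ K → ∀ D : ℝ, (∀ y ∈ Δ, ∀ z, z ∉ Λ → D ≤ ‖y.1 - z.1‖) →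
        |(∫ U, F U ∂(ymSpecification (d := 3) (fundamentalRep (Fin 2)) (βW / 2) Λ η)) - ∫ U, F U ∂μ| ≤
          2 * Real.sqrt 2 * K * Δ.card * (4 * βW) ^ ⌊D⌋₊)

/-- T58b_SU2Dim3BoundaryRate holds. -/
theorem T58b_SU2Dim3BoundaryRate_holds : T58b_SU2Dim3BoundaryRate :=
  ⟨fun _ h0 h _ hμ Λ η _ _ _ hF _ hD => su2_wilson_boundary_dim3_upTo_oneEighth h0 h hμ Λ η hF hD,
    fun _ h0 h _ hμ Λ η _ _ _ hF _ hD => su2_wilson_boundary_dim3_lt_oneQuarter h0 h hμ Λ η hF hD⟩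

end V22_ds3_PartF

/-! ### OWNER FILE `ds/ds3/lean/g12/texts/V1XConjunctsDS3g12G.lean` (sha16 63aad1deced79fea) — section `V22_ds3_PartG` -/
section V22_ds3_PartG

/-!
Statement v1.x candidate conjuncts from ds-3's gen-12 files, PART G (TEXT for the p3 seat; checkable once `WilsonLoopBoundaryDecay.lean`
(p368411, ACCEPTED 13c7d3e9b19a) and `FreeBoundaryDecay.lean` (p368075, ACCEPTED b68e637a0b6f) are built; NOT proposed by ds-3). Y2 ROBUST-BALL:
ONE STATE AT A RATE for WILSON LOOPS, and for FREE boundary conditions. HONEST LABEL: Dobrushin-comparison lower bounds on the rate; lattice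
strong coupling; nothing continuum.
-/

open MeasureTheory Filter Topology SimpleGraph
open scoped NNReal
open Literature.Probability.LatticeModels hiding configShift configShift_apply
open Literature.MathematicalPhysics.QuantumLattice
open Literature.MathematicalPhysics.QuantumFieldTheory hiding ZdEdge Site
open Literature.MathematicalPhysics.QuantumFieldTheory (walkEdges)
open Summit.Ventures.YMGap
open Summit.Ventures.YMGap.RobustBall

/-- **T59a_SU2WilsonLoopBoundaryRate — `SU(2)` on `ℤ⁴`, `0 ≤ β_W ≤ 1/12`** (tree coupling `β_W/2`): for EVERY DLR state `μ`, every finite volume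
`Λ`, EVERY boundary field `η` and every closed lattice walk `γ` whose links are at base-point depth `≥ D` in `Λ`, the Wilson loop `W_γ = Re tr U_γ/2`
(rb-p1's `loopTerm 2 1 γ`) satisfies `|⟨W_γ⟩_{Λ,η} − ⟨W_γ⟩_μ| ≤ 4 · |γ|² · (1/2)^{⌊D⌋}` (`RobustBall.su2_wilson_loop_boundary_upTo_oneTwelfth`). -/
def T59a_SU2WilsonLoopBoundaryRate : Prop :=
  ∀ (βW : ℝ), 0 ≤ βW → βW ≤ 1 / 12 →
    ∀ μ ∈ ymGibbsMeasures (d := 4) (fundamentalRep (Fin 2)) (βW / 2),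
    ∀ (Λ : Finset (ZdEdge 4)) (η : LGConfig 4 (Matrix.specialUnitaryGroup (Fin 2) ℂ)) (x : Site 4) (w : (zdGraph 4).Walk x x) (D : ℝ),
      (∀ y ∈ walkEdges w, ∀ z, z ∉ Λ → D ≤ ‖y.1 - z.1‖) →
        |(∫ U, loopTerm 2 1 w U ∂(ymSpecification (d := 4) (fundamentalRep (Fin 2)) (βW / 2) Λ η)) - ∫ U, loopTerm 2 1 w U ∂μ| ≤
          4 * (w.length : ℝ) ^ 2 * (1 / 2 : ℝ) ^ ⌊D⌋₊

/-- T59a_SU2WilsonLoopBoundaryRate holds. -/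
theorem T59a_SU2WilsonLoopBoundaryRate_holds : T59a_SU2WilsonLoopBoundaryRate :=
  fun _ h0 h _ hμ Λ η _ w _ hD => su2_wilson_loop_boundary_upTo_oneTwelfth h0 h hμ Λ η w hD

/-- **T59b_SU2FreeBoundaryRate — FREE BOUNDARY CONDITIONS, `SU(2)` on `ℤ⁴`, `0 ≤ β_W ≤ 1/12`** (tree coupling `β_W/2`): for EVERY DLR state `μ`, every
finite site region `Λs`, every link set `Λ` whose plaquettes have their corners in `Λs`, and every Lipschitz cylinder `F` (constant `K`, links `Δ`
at depth `≥ D` in `Λ`): `|∫ F dμ^{free}_{Λs, β_W/2} − ∫ F dμ| ≤ 4√2 · K · #Δ · (1/2)^{⌊D⌋}` (lit `zdWilsonMeasure`;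
`RobustBall.su2_wilson_free_upTo_oneTwelfth`). -/
def T59b_SU2FreeBoundaryRate : Prop :=
  ∀ (βW : ℝ), 0 ≤ βW → βW ≤ 1 / 12 →
    ∀ μ ∈ ymGibbsMeasures (d := 4) (fundamentalRep (Fin 2)) (βW / 2),
    ∀ (Λs : Finset (Site 4)) (Λ : Finset (ZdEdge 4)),
      (∀ x ∈ Λ, ∀ p ∈ plaquettesTouching {x}, ((p.1, p.2.1.1, p.2.1.2) : Plaq 4) ∈ plaquettesIn Λs) →
      ∀ (F : LGConfig 4 (Matrix.specialUnitaryGroup (Fin 2) ℂ) → ℝ) (Δ : Finset (ZdEdge 4)) (K : ℝ≥0),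
        IsLipschitzCylinder (fundamentalRep (Fin 2)) F Δ K → ∀ D : ℝ, (∀ y ∈ Δ, ∀ z, z ∉ Λ → D ≤ ‖y.1 - z.1‖) →
          |(∫ U, F U ∂(zdWilsonMeasure (d := 4) (fundamentalRep (Fin 2)) (βW / 2) Λs)) - ∫ U, F U ∂μ| ≤
            4 * Real.sqrt 2 * K * Δ.card * (1 / 2 : ℝ) ^ ⌊D⌋₊

/-- T59b_SU2FreeBoundaryRate holds. -/
theorem T59b_SU2FreeBoundaryRate_holds : T59b_SU2FreeBoundaryRate :=
  fun _ h0 h _ hμ Λs Λ hΛ _ _ _ hF _ hD => su2_wilson_free_upTo_oneTwelfth h0 h hμ Λs Λ hΛ hF hD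

end V22_ds3_PartG

/-! ### OWNER FILE `p2/v22-prestage/T-texts-p2g11.lean` (sha16 38831d14bcc5cda6) — section `V22_p2_T46` -/
section V22_p2_T46

/-!
# Venture statement — YMGap (cell `pub-ymgap`) — OWNER TEXT for the conjunct reserved as «T46» (track (a): the EVERY-`N` LEVEL-TWO
# ONE-LINK LADDER — mass-gap thresholds on `ℤ⁴`, the area law in every dimension, and the `d = 3, 5, …, 8` ladders) (seat p2 g11)

STATUS: owner text for the lead's V22 booking (R253 (c) «T46 (p2 K₂B/K₂BT ladder) → V21, booked when p2 g10's K₂BT column lands with commits»;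
R274/R288: the column is FINAL AT LEVEL TWO; lead 2026-08-23T17:58:53Z «T46 rides V22 on p2's landed rows»).  Numbering and composition are the
lead's at the Mon 2026-08-24T00:00Z cut; p3 files.  Bodies close by TREE constants only: `Thresholds/OneLinkLevelTwoBootTildeRows.lean` (p365981,
commit 2c68edf3bc53), `Thresholds/OneLinkLevelTwoBootRowsMore.lean` (355ed9b8b2d0), `Thresholds/OneLinkLevelTwoBootTildeAreaLaw.lean` (p367459,
b4e066eb7a38), `Thresholds/OneLinkLevelTwoBootTildeDimRows.lean` (p367463, b4e066eb7a38).  Data sheet: `HOME/p2/DATA-ROWS-p2.md` §F.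

HONEST FRAMING. WHAT THIS IS: kernel-checked, HYPOTHESIS-FREE strong-coupling LATTICE statements for `SU(N)` lattice Yang–Mills with the Wilson
action (tree coupling `N·x`, 't Hooft `x`): (i) for every `N ≥ N₀` the track-(a) target type `ImprovedThreshold 4 N x₀` (`1/48 < x₀` AND the mass gap
`MassGapAt 4 N x` — unique DLR state + exponential clustering of Lipschitz cylinders — at every `|x| < x₀`) along the ladder
`N₀ = 3, 4, 5, 6, 8, 10, 12, 20, 50 ↦ x₀ = 33/1000, 19/500, 1/25, 1/24, 13/300, 11/250, 89/2000, 91/2000, 11/240`, i.e. `+22 … +47 %` over the sharp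
Bakry–Émery threshold `1/32` of T16 and `×1.8 … ×2.2` over Shen–Zhu–Zhu's printed `1/48`; (ii) the Wilson AREA LAW `HasAreaLaw d χ_N (N·β)` in EVERY
dimension `d ≥ 2` for `0 ≤ β` with `2(d−1)β ≤ 139/500, 3/10, 19/60, 81/250, 49/150` for `N ≥ 4, 6, 10, 20, 50` (`d = 4`: `β ≤ 0.0463 … 0.0544`; printed
Cao–Nissim–Sheffield `β < 1/(8(d−1))`, `d = 4`: `1/24 ≈ 0.0417`); (iii) the `d = 3` ladder `36/625, 159/2500, 42/625, 69/1000, 87/1250` (`N ≥ 4/6/10/20/50`)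
and the `N ≥ 10` rows in `d = 5, 6, 7, 8`.  Mechanism: the `ω̃`-bootstrap level-two one-link Kantorovich–Rubinstein modulus `K₂BT(N, R)` (`K₂B` for the
`N ≥ 3` row) through ds-1's vertex-star door / the slab door / the any-`d` socket.  HONEST LABEL: every threshold is where a Dobrushin-type BOUND
closes (a door artefact of the level-two hierarchy, which is exhausted at this accuracy — cell note `HOME/p2/ONE-LINK-HIERARCHY.md` §17), not a
physical transition; sentence-grade column (lead R140/R164), ADDITIONAL to T11 (`9/308`) and T16 (`1/(8d)`), which stay.  WHAT THIS IS NOT: no decay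
rate beyond `∃ c > 0`, nothing about the crossover, the continuum, or the Clay problem.
-/



section T46sec

open Literature.MathematicalPhysics.QuantumLattice
open Literature.MathematicalPhysics.QuantumFieldTheory
open Summit.Ventures.YMGap.OneLinkEigen

/-- **T46a_SUNLevelTwoThresholdLadder — `ℤ⁴`, every `N ≥ N₀`, HYPOTHESIS-FREE**: `ImprovedThreshold 4 N x₀` (`1/48 < x₀` and `MassGapAt 4 N x` for every
't Hooft `|x| < x₀`) for `(N₀, x₀) = (3, 33/1000), (4, 19/500), (5, 1/25), (6, 1/24), (8, 13/300), (10, 11/250), (12, 89/2000), (20, 91/2000), (50, 11/240)`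
(`OneLinkEigen.improvedThreshold_SU_levelTwoB_three`, `improvedThreshold_SU_levelTwoBT_four/…/fifty`).  Sharp Bakry–Émery `1/32` (T16); printed `1/48`. -/
def T46a_SUNLevelTwoThresholdLadder : Prop :=
  (∀ N : ℕ, 3 ≤ N → ImprovedThreshold 4 N (33 / 1000)) ∧
  (∀ N : ℕ, 4 ≤ N → ImprovedThreshold 4 N (19 / 500)) ∧
  (∀ N : ℕ, 5 ≤ N → ImprovedThreshold 4 N (1 / 25)) ∧
  (∀ N : ℕ, 6 ≤ N → ImprovedThreshold 4 N (1 / 24)) ∧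
  (∀ N : ℕ, 8 ≤ N → ImprovedThreshold 4 N (13 / 300)) ∧
  (∀ N : ℕ, 10 ≤ N → ImprovedThreshold 4 N (11 / 250)) ∧
  (∀ N : ℕ, 12 ≤ N → ImprovedThreshold 4 N (89 / 2000)) ∧
  (∀ N : ℕ, 20 ≤ N → ImprovedThreshold 4 N (91 / 2000)) ∧
  (∀ N : ℕ, 50 ≤ N → ImprovedThreshold 4 N (11 / 240))

/-- T46a_SUNLevelTwoThresholdLadder holds. -/
theorem T46a_SUNLevelTwoThresholdLadder_holds : T46a_SUNLevelTwoThresholdLadder :=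
  ⟨fun _ hN => improvedThreshold_SU_levelTwoB_three hN, fun _ hN => improvedThreshold_SU_levelTwoBT_four hN,
    fun _ hN => improvedThreshold_SU_levelTwoBT_five hN, fun _ hN => improvedThreshold_SU_levelTwoBT_six hN,
    fun _ hN => improvedThreshold_SU_levelTwoBT_eight hN, fun _ hN => improvedThreshold_SU_levelTwoBT_ten hN,
    fun _ hN => improvedThreshold_SU_levelTwoBT_twelve hN, fun _ hN => improvedThreshold_SU_levelTwoBT_twenty hN,
    fun _ hN => improvedThreshold_SU_levelTwoBT_fifty hN⟩

/-- **T46b_SUNLevelTwoAreaLaw — the Wilson AREA LAW in EVERY dimension `d ≥ 2`, HYPOTHESIS-FREE**: for `N ≥ 4, 6, 10, 20, 50` and every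
't Hooft `0 ≤ β` with `2(d−1)β ≤ 139/500, 3/10, 19/60, 81/250, 49/150` respectively, `HasAreaLaw d χ_N (N·β)`
(`OneLinkEigen.hasAreaLaw_SU_levelTwoBT_four/six/ten/twenty/fifty`; the slab door + the tree theorem `durhuusFrohlich_areaLaw_of_slabClustering_holds`).
`d = 4`: `β ≤ 139/3000, 1/20, 19/360, 27/500, 49/900`; printed Cao–Nissim–Sheffield `1/(8(d−1))`. -/
def T46b_SUNLevelTwoAreaLaw : Prop :=
  (∀ d N : ℕ, 2 ≤ d → 4 ≤ N → ∀ β : ℝ, 0 ≤ β → β * (2 * ((d : ℝ) - 1)) ≤ 139 / 500 →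
      HasAreaLaw d (fundamentalRep (Fin N)) ((N : ℝ) * β)) ∧
  (∀ d N : ℕ, 2 ≤ d → 6 ≤ N → ∀ β : ℝ, 0 ≤ β → β * (2 * ((d : ℝ) - 1)) ≤ 3 / 10 →
      HasAreaLaw d (fundamentalRep (Fin N)) ((N : ℝ) * β)) ∧
  (∀ d N : ℕ, 2 ≤ d → 10 ≤ N → ∀ β : ℝ, 0 ≤ β → β * (2 * ((d : ℝ) - 1)) ≤ 19 / 60 →
      HasAreaLaw d (fundamentalRep (Fin N)) ((N : ℝ) * β)) ∧
  (∀ d N : ℕ, 2 ≤ d → 20 ≤ N → ∀ β : ℝ, 0 ≤ β → β * (2 * ((d : ℝ) - 1)) ≤ 81 / 250 →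
      HasAreaLaw d (fundamentalRep (Fin N)) ((N : ℝ) * β)) ∧
  (∀ d N : ℕ, 2 ≤ d → 50 ≤ N → ∀ β : ℝ, 0 ≤ β → β * (2 * ((d : ℝ) - 1)) ≤ 49 / 150 →
      HasAreaLaw d (fundamentalRep (Fin N)) ((N : ℝ) * β))

/-- T46b_SUNLevelTwoAreaLaw holds. -/
theorem T46b_SUNLevelTwoAreaLaw_holds : T46b_SUNLevelTwoAreaLaw :=
  ⟨fun _ _ hd hN _ hβ h => hasAreaLaw_SU_levelTwoBT_four hd hN hβ h,
    fun _ _ hd hN _ hβ h => hasAreaLaw_SU_levelTwoBT_six hd hN hβ h,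
    fun _ _ hd hN _ hβ h => hasAreaLaw_SU_levelTwoBT_ten hd hN hβ h,
    fun _ _ hd hN _ hβ h => hasAreaLaw_SU_levelTwoBT_twenty hd hN hβ h,
    fun _ _ hd hN _ hβ h => hasAreaLaw_SU_levelTwoBT_fifty hd hN hβ h⟩

/-- **T46c_SUNLevelTwoDimLadder — the ladders in `d = 3` and `d = 5 … 8`, HYPOTHESIS-FREE** (ds-1's any-`d` socket): `d = 3`:
`ImprovedThreshold 3 N x₀` for `(N₀, x₀) = (4, 36/625), (6, 159/2500), (10, 42/625), (20, 69/1000), (50, 87/1250)`; every `N ≥ 10`: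
`ImprovedThreshold 5 N (33/1000)`, `ImprovedThreshold 6 N (13/500)`, `ImprovedThreshold 7 N (13/600)`, `ImprovedThreshold 8 N (37/2000)`
(`OneLinkEigen.improvedThreshold_SU_three_levelTwoBT_four/…/fifty`, `…_SU_five/six/seven/eight_levelTwoBT_ten`).  Printed `1/(16(d−1))`. -/
def T46c_SUNLevelTwoDimLadder : Prop :=
  (∀ N : ℕ, 4 ≤ N → ImprovedThreshold 3 N (36 / 625)) ∧
  (∀ N : ℕ, 6 ≤ N → ImprovedThreshold 3 N (159 / 2500)) ∧
  (∀ N : ℕ, 10 ≤ N → ImprovedThreshold 3 N (42 / 625)) ∧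
  (∀ N : ℕ, 20 ≤ N → ImprovedThreshold 3 N (69 / 1000)) ∧
  (∀ N : ℕ, 50 ≤ N → ImprovedThreshold 3 N (87 / 1250)) ∧
  (∀ N : ℕ, 10 ≤ N → ImprovedThreshold 5 N (33 / 1000)) ∧
  (∀ N : ℕ, 10 ≤ N → ImprovedThreshold 6 N (13 / 500)) ∧
  (∀ N : ℕ, 10 ≤ N → ImprovedThreshold 7 N (13 / 600)) ∧
  (∀ N : ℕ, 10 ≤ N → ImprovedThreshold 8 N (37 / 2000))

/-- T46c_SUNLevelTwoDimLadder holds. -/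
theorem T46c_SUNLevelTwoDimLadder_holds : T46c_SUNLevelTwoDimLadder :=
  ⟨fun _ hN => improvedThreshold_SU_three_levelTwoBT_four hN, fun _ hN => improvedThreshold_SU_three_levelTwoBT_six hN,
    fun _ hN => improvedThreshold_SU_three_levelTwoBT_ten hN, fun _ hN => improvedThreshold_SU_three_levelTwoBT_twenty hN,
    fun _ hN => improvedThreshold_SU_three_levelTwoBT_fifty hN, fun _ hN => improvedThreshold_SU_five_levelTwoBT_ten hN,
    fun _ hN => improvedThreshold_SU_six_levelTwoBT_ten hN, fun _ hN => improvedThreshold_SU_seven_levelTwoBT_ten hN,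
    fun _ hN => improvedThreshold_SU_eight_levelTwoBT_ten hN⟩

/-- **T46 candidate — track (a): THE EVERY-`N` LEVEL-TWO ONE-LINK LADDER, HYPOTHESIS-FREE** (seat p2; the three parts above): (i) `ℤ⁴` thresholds
`ImprovedThreshold 4 N x₀` along `N₀ = 3 … 50 ↦ x₀ = 33/1000 … 11/240` (sup of the column `0.046`; sharp Bakry–Émery `1/32`, printed `1/48`); (ii) the
Wilson area law in every `d ≥ 2` on `2(d−1)β ≤ 139/500 … 49/150` (`N ≥ 4 … 50`; `d = 4`, `N ≥ 6`: `β ≤ 1/20` vs printed `1/24`); (iii) the `d = 3`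
ladder and the `N ≥ 10` rows in `d = 5 … 8`.  HONEST LABEL: strong-coupling lattice statements; thresholds are artefacts of the level-two one-link
modulus (final at this level), sentence-grade; nothing continuum / Clay. -/
def T46_SUNLevelTwoLadder : Prop :=
  T46a_SUNLevelTwoThresholdLadder ∧ T46b_SUNLevelTwoAreaLaw ∧ T46c_SUNLevelTwoDimLadder

/-- The T46 candidate holds. -/
theorem T46_SUNLevelTwoLadder_holds : T46_SUNLevelTwoLadder :=
  ⟨T46a_SUNLevelTwoThresholdLadder_holds, T46b_SUNLevelTwoAreaLaw_holds, T46c_SUNLevelTwoDimLadder_holds⟩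

end T46sec



end V22_p2_T46

/-! ### OWNER FILE `p2/v22-prestage/T-texts-engine2-PV2-countersigned.lean` (sha16 1c4332b7d1ec2429) — section `V22_eng2_PV2` -/
section V22_eng2_PV2

/-!
# Venture statement — YMGap (cell `pub-ymgap`) — owner text «engine-2 PV2 every-d SU(3)» for the lead's V22 list — DRAFTED BY p2 g11 FROM THE
# TREE DECLARATIONS (T44 precedent: p3 drafts from named decls, the OWNER COUNTERSIGNS) and COUNTERSIGNED AS TYPED BY engine-2 g11
# (2026-08-23T19:33:37Z, HOME/INBOX.md l.4368: «binders verbatim … nothing weakened»; one header wording correction + a NOT CLAIMED clause,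
# both applied below by p2 g12; the two `def`s, their types and the `_holds` proofs are byte-identical to the countersigned draft 1da0195b97bcc345).

STATUS: owner text for the V22 pre-stage (lead R288 (2) names «engine-2 PV2 every-d SU(3)»; engine-2 g10 posted no text file before its wall; engine-2 g11
countersigned this draft).  Bodies = the
TYPES of the named tree theorems with their hypotheses as binders, nothing weakened: `Thresholds/StarSU3PV2DimRows.lean` (p366929, commit 713800a4255c;
namespace `Summit.Ventures.YMGap.StarSU3PV2Dim`), `RobustBall/MassGapOnBallZdGRowsSU3PV2.lean` (p368062, 1ed95d0d59df), `RobustBall/StarRowsSU3PV2Dim3.lean`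
(p368070, 1ed95d0d59df).  The lead numbers / composes; engine-2 g11 may REPLACE this text by one with larger radii if its twisted-Bochner rows are
ACCEPTED + built before 22:30Z (its countersign line); otherwise these two texts stand for V22 as countersigned.

HONEST FRAMING. WHAT THIS IS: kernel-checked strong-coupling LATTICE statements for `SU(3)` lattice Yang–Mills, HYPOTHESIS-FREE («no displayed one-link
hypothesis»: the one-link input is engine-2 g10's PV2 centred Schwinger–Dyson variance modulus (`Thresholds/OneLinkVarianceSDCentred.lean` 2565c8a1db7b:
`oneLinkVarianceBound_sdc`, `oneLinkKRModulus_pv2`), built on p2's Schwinger–Dyson identity `OneLinkSDMeans.integral_reTrProdConj_eq` and Bakry–Émery's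
Poincaré constant — a tree theorem): (i) in EVERY dimension `d ≥ 2`, the mass gap `MassGapAt d 3 (β_W/9)`
(unique DLR state + exponential clustering; tree coupling `β_W/3 = 3·(β_W/9)`) whenever `(d−1)|β_W| ≤ 19/20`; (ii) the small-`d` rows `|β_W| ≤ 53/100 (d = 3)`,
`87/250 (d = 4)`, `1/4 (d = 5)`, `41/200 (d = 6)`; (iii) the track-(a) target types `ImprovedThreshold d 3 x₀` for `(d, x₀) = (3, 53/900), (4, 29/750), (5, 1/36),
(6, 41/1800)` ('t Hooft units `x = β_W/9`; printed Shen–Zhu–Zhu `1/(16(d−1))`); (iv) ROBUST versions on the gauge-invariant finite-range tier-1 ball: the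
SEGMENTS `MassGapOnBallZdG 4 3 (β_W/9) (11/500) (11/1000) R` for every `0 ≤ β_W ≤ 17/50` and `MassGapOnBallZdG 3 3 (β_W/9) (3/125) (3/250) R` for every
`0 ≤ β_W ≤ 13/25`, every range `R`.  HONEST LABEL: thresholds / radii are where the PV2 star-door bound closes (door artefacts), strong coupling only; the
`SU(3)` PV column supersedes T44 (v)/(vi)'s PV segments in reach, not in kind; nothing about the crossover, the continuum, or the Clay problem.
NOT CLAIMED (engine-2 g11, verbatim): anything for SU(2); uniformity in N; any change to the CERTIFIED (H1 ∧ H2) SU(3) column; sharpness of the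
thresholds (door artefacts); anything beyond strong coupling / about the continuum.
-/



section Engine2PV2sec

open Literature.MathematicalPhysics.QuantumLattice
open Literature.MathematicalPhysics.QuantumFieldTheory
open Summit.Ventures.YMGap.RobustBall
open Summit.Ventures.YMGap.StarSU3PV2Dim

/-- **T60a_SU3EveryDimensionPV2 (engine-2 PV2; drafted by p2 g11 from the tree decls, countersigned as typed by engine-2 g11 2026-08-23T19:33:37Z) — `SU(3)`, EVERY `d ≥ 2`, HYPOTHESIS-FREE**: (i) `(d−1)|β_W| ≤ 19/20 ⇒ MassGapAt d 3 (β_W/9)`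
(`StarSU3PV2Dim.su3_massGapAt_dim_pv2_uniform`); (ii) `d = 3, 4, 5, 6` rows at `|β_W| ≤ 53/100, 87/250, 1/4, 41/200` (`su3_three/four/five/six_massGapAt_pv2`);
(iii) `ImprovedThreshold 3 3 (53/900) ∧ ImprovedThreshold 4 3 (29/750) ∧ ImprovedThreshold 5 3 (1/36) ∧ ImprovedThreshold 6 3 (41/1800)`
(`improvedThreshold_su3_three/four/five/six_pv2`). -/
def T60a_SU3EveryDimensionPV2 : Prop :=
  (∀ d : ℕ, 2 ≤ d → ∀ βW : ℝ, ((d : ℝ) - 1) * |βW| ≤ 19 / 20 → MassGapAt d 3 (βW / 9)) ∧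
  (∀ βW : ℝ, |βW| ≤ 53 / 100 → MassGapAt 3 3 (βW / 9)) ∧
  (∀ βW : ℝ, |βW| ≤ 87 / 250 → MassGapAt 4 3 (βW / 9)) ∧
  (∀ βW : ℝ, |βW| ≤ 1 / 4 → MassGapAt 5 3 (βW / 9)) ∧
  (∀ βW : ℝ, |βW| ≤ 41 / 200 → MassGapAt 6 3 (βW / 9)) ∧
  (ImprovedThreshold 3 3 (53 / 900) ∧ ImprovedThreshold 4 3 (29 / 750) ∧ ImprovedThreshold 5 3 (1 / 36) ∧ ImprovedThreshold 6 3 (41 / 1800))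

/-- T60a_SU3EveryDimensionPV2 holds. -/
theorem T60a_SU3EveryDimensionPV2_holds : T60a_SU3EveryDimensionPV2 :=
  ⟨fun _ hd _ h => su3_massGapAt_dim_pv2_uniform hd h, fun _ h => su3_three_massGapAt_pv2 h, fun _ h => su3_four_massGapAt_pv2 h,
    fun _ h => su3_five_massGapAt_pv2 h, fun _ h => su3_six_massGapAt_pv2 h,
    ⟨improvedThreshold_su3_three_pv2, improvedThreshold_su3_four_pv2, improvedThreshold_su3_five_pv2, improvedThreshold_su3_six_pv2⟩⟩

/-- **T60b_SU3BallSegmentsPV2 (engine-2 PV2; drafted by p2 g11 from the tree decls, countersigned as typed by engine-2 g11 2026-08-23T19:33:37Z) — `SU(3)`, the PV2 SEGMENTS on the gauge-invariant tier-1 ball, HYPOTHESIS-FREE**: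
`∀ 0 ≤ β_W ≤ 17/50, ∀ R, MassGapOnBallZdG 4 3 (β_W/9) (11/500) (11/1000) R` (`RobustBall.su3_massGapOnBallZdG_pv2Star_upTo_seventeenFiftieths`) and
`∀ 0 ≤ β_W ≤ 13/25, ∀ R, MassGapOnBallZdG 3 3 (β_W/9) (3/125) (3/250) R` (`RobustBall.su3_massGapOnBallZdG_dim3_pv2Star_upTo_thirteenTwentyFifths`). -/
def T60b_SU3BallSegmentsPV2 : Prop :=
  (∀ βW : ℝ, 0 ≤ βW → βW ≤ 17 / 50 → ∀ R : ℕ, MassGapOnBallZdG 4 3 (βW / 9) (11 / 500) (11 / 1000) R) ∧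
  (∀ βW : ℝ, 0 ≤ βW → βW ≤ 13 / 25 → ∀ R : ℕ, MassGapOnBallZdG 3 3 (βW / 9) (3 / 125) (3 / 250) R)

/-- T60b_SU3BallSegmentsPV2 holds. -/
theorem T60b_SU3BallSegmentsPV2_holds : T60b_SU3BallSegmentsPV2 :=
  ⟨fun _ h0 h R => su3_massGapOnBallZdG_pv2Star_upTo_seventeenFiftieths h0 h R,
    fun _ h0 h R => su3_massGapOnBallZdG_dim3_pv2Star_upTo_thirteenTwentyFifths h0 h R⟩

end Engine2PV2sec



end V22_eng2_PV2

/-! ### DEFAULT GROUPING (p2): one consolidating conjunction per owner file — `G_<tag> := T_a ∧ T_b ∧ …` + `_holds`.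
The lead composes V22 by theme; p3 renames `G_<tag> ↦ T<k>_<Name>` (via --map) or regroups at will; these are additions, not owner bytes. -/
section V22_groups_B

/-- Default group for section `V22_ds3_PartF`: the conjunction of its 2 owner texts. -/
def T58_BoundaryRateMixedAndDim3 : Prop :=
  T58a_SU2MixedActionBoundaryRate ∧ T58b_SU2Dim3BoundaryRate

/-- `T58_BoundaryRateMixedAndDim3` holds (componentwise by the owners' `_holds`). -/
theorem T58_BoundaryRateMixedAndDim3_holds : T58_BoundaryRateMixedAndDim3 :=
  ⟨T58a_SU2MixedActionBoundaryRate_holds, T58b_SU2Dim3BoundaryRate_holds⟩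

/-- Default group for section `V22_ds3_PartG`: the conjunction of its 2 owner texts. -/
def T59_LoopAndFreeBoundaryRate : Prop :=
  T59a_SU2WilsonLoopBoundaryRate ∧ T59b_SU2FreeBoundaryRate

/-- `T59_LoopAndFreeBoundaryRate` holds (componentwise by the owners' `_holds`). -/
theorem T59_LoopAndFreeBoundaryRate_holds : T59_LoopAndFreeBoundaryRate :=
  ⟨T59a_SU2WilsonLoopBoundaryRate_holds, T59b_SU2FreeBoundaryRate_holds⟩

/-- Default group for section `V22_eng2_PV2`: the conjunction of its 2 owner texts. -/
def T60_SU3PV2Column : Prop :=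
  T60a_SU3EveryDimensionPV2 ∧ T60b_SU3BallSegmentsPV2

/-- `T60_SU3PV2Column` holds (componentwise by the owners' `_holds`). -/
theorem T60_SU3PV2Column_holds : T60_SU3PV2Column :=
  ⟨T60a_SU3EveryDimensionPV2_holds, T60b_SU3BallSegmentsPV2_holds⟩

end V22_groups_B

end Summit.Ventures.YMGap

end
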